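import Literature.Barriers.Parity.SmallScalePatternsFrame
import Literature.Barriers.Parity.SmallScalePatternsAP
import Literature.Barriers.Parity.EquidistributionLimitsMaierProofs
import HarnessLib

/-!
# Small-scale irregularity of linear patterns of primes: systems with a dual frame, PROVED

Proof companion of `Literature/Barriers/Parity/SmallScalePatterns.lean` (Pandey–Woo 2024,
Theorem 5 = the named fact `SmallScalePatternIrregularity`). Everything here is PROVED. Main
results:

* `Frame.irregularity` / `smallScalePatternIrregularity_of_frame` /
  `smallScalePatternIrregularity_of_surjective` — the conclusion of
  `SmallScalePatternIrregularity` for every in-scope system `Ψ = (ψ₁, …, ψ_t)` on `ℤ^d`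
  (any `t, d ≥ 1`) admitting a dual frame `v₁, …, v_t ∈ ℤ^d`, `ψᵢ(v_l) = δ_{il}`
  (`Frame.IsDualFrame`; equivalently `Ψ : ℤ^d → ℤ^t` onto — the systems of complexity `0` without
  lattice obstruction, all of whose local factors are `1`): for every `λ > 1` there are `δ± > 0`
  such that for arbitrarily large `X`, `H = (log X)^λ`, some box `∏ⱼ [xⱼ, xⱼ + H]` with corner
  in `[X, 2X]^d` contains `≥ (1 + δ⁺) H^d (log X)^{-t} ∏_p β_p` points `n` with all `ψᵢ(n)`
  prime and another `≤ (1 − δ⁻) H^d (log X)^{-t} ∏_p β_p` of them;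
* `apSystem_two_isDualFrame`, `smallScalePatternIrregularity_apSystem_two`,
  `not_smallScaleUniformity_apSystem_two` — the system `apSystem 2 = (x, x + y)` of
  `SmallScalePatternsAP.lean` (pairs of primes `p < p'` located by `p` and the gap `p' − p`), a
  genuinely two-form instance, for which the AP file's conditional
  `SmallScalePatternIrregularity.not_smallScaleUniformity_apSystem` thus holds unconditionally;
  `not_smallScaleUniformity_of_frame`.

The general case of the fact (systems of complexity `≥ 1`, e.g. `(x, x+y, x+2y, x+3y)`) is
Pandey–Woo's theorem proper (Green–Tao–Ziegler machinery in progressions, Matthiesen's theorem)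
and is NOT proved here; the named fact stays a `def`.

## Proof

As in the case `t = 1` (`SmallScalePatternsProofs.lean`) take `A = λ + 2` and Maier's rows from
the tree (`Maier.matrix_rows`): a window `(m, m + h₁]`, `N < m ≤ 2N`, `h₁ = ⌊log^A N⌋`, with
`≥ h₁(1 + η₁/4)/log 3N` primes, and at the adapted scale `N' = ⌊7m/10⌋` a window `(m', m' + h₂]`
with `≤ h₂(1 − η₂/4)/log N'` primes. Write `m + 1 = σq + r` (`σ = ∑ⱼ ψ_{i₀}(eⱼ)`) and walk from
the base point `b = q𝟙 + r v_{i₀}` (so `ψ_{i₀}(b) = m + 1`, `ψᵢ(b) = σᵢ q` for `i ≠ i₀`) along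
the frame: `z_k = b + ∑_l k_l v_l`, `k_{i₀} < h₁`, `k_l < h_L = ⌊N/K⌋` (`l ≠ i₀`). By
`Frame.le_walk_sum` the boxes `z_k + {0,…,H}^d` carry in total at least
`(H+1)^d ∏ᵢ (Rᵢ − σᵢ H)` prime patterns, where `R_{i₀} ≥ h₁(1+η₁/4)/log 3N` (Maier) and, for
`i ≠ i₀`, `Rᵢ = π(σᵢq − 1 + h_L) − π(σᵢ q − 1) = (1 + o(1)) h_L/log X` by the prime number theorem
in the long windows (`Frame.eventually_theta_window`); pigeonholing over `k` gives a box with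
`≥ (1 + η₁/10) H^d/(log X)^t` prime patterns (`Frame.frame_surplus_final`), and symmetrically a
box with `≤ (1 − η₂/25) H^d/(log X)^t` from the deficit row (`Frame.walk_sum_le`,
`Frame.frame_deficit_final`); `K = 15σ(∑|v_{l,j}| + 1)` keeps all corners in one range `[X, 2X]^d`
(`SingleForm.corner_geometry`). [cite: PandeyWoo2024, Theorem 5 and §2.4] [cite: Maier1985, Theorem]

## References

* M. Pandey, K. Woo, *Small scale distribution of linear patterns of primes*, J. London Math.
  Soc. 110 (2024) e13001, arXiv:2304.14267: Theorem 5, §2.4 (`PandeyWoo2024`).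
* H. Maier, *Primes in short intervals*, Michigan Math. J. 32 (1985), 221–225 (`Maier1985`).
* B. Green, T. Tao, *Linear equations in primes*, Ann. of Math. 171 (2010), Def. 1.5 and the
  discussion of complexity `0` (`GreenTao2010`).
-/

noncomputable section

open Filter Finset Topology

namespace Literature.Barriers.Parity

open Literature.NumberTheory.Sieve Literature.Barriers.Parity.Maier SingleForm Frame

variable {d t : ℕ}

namespace Frame

/-! ## Small lemmas on the base point and the corners -/

/-- `ψᵢ(q𝟙 + ∑_l c_l v_l) = σᵢ q + cᵢ` along a dual frame, `σᵢ = ∑ⱼ ψᵢ(eⱼ)`. [folklore] -/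
theorem eval_base (Ψ : Fin t → AffLinForm d) (h0 : ∀ i, (Ψ i).const = 0)
    {v : Fin t → Fin d → ℤ} (hv : IsDualFrame Ψ v) (q : ℤ) (c : Fin t → ℤ) (i : Fin t) :
    (Ψ i).eval (fun j => q + ∑ l, c l * v l j) = (∑ j, (Ψ i).coeff j) * q + c i := by
  have h1 := eval_corner Ψ h0 hv (fun _ => q) c i
  have h2 : (Ψ i).eval (fun _ : Fin d => q) = (∑ j, (Ψ i).coeff j) * q := by
    rw [eval_eq_sum _ (h0 i), sum_mul]
  rw [h2] at h1
  exact h1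

/-- The corners stay near `q𝟙`: if `|c_l| + k_l ≤ B` (`B ≥ 0`) for all `l` then
`|q + ∑_l c_l v_{l,j} + ∑_l k_l v_{l,j} − q| ≤ B ∑_l ∑_{j'} |v_{l,j'}|`. [folklore] -/
theorem abs_corner_sub_le' (v : Fin t → Fin d → ℤ) (q : ℤ) (c : Fin t → ℤ) (k : Fin t → ℕ)
    {B : ℤ} (hB0 : 0 ≤ B) (hB : ∀ l, |c l| + k l ≤ B) (j : Fin d) :
    |(q + ∑ l, c l * v l j) + ∑ l, (k l : ℤ) * v l j - q| ≤ B * ∑ l, ∑ j', |v l j'| := by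
  have e : (q + ∑ l, c l * v l j) + ∑ l, (k l : ℤ) * v l j - q = ∑ l, (c l + k l) * v l j := by
    have : ∑ l, (c l + (k l : ℤ)) * v l j = ∑ l, c l * v l j + ∑ l, (k l : ℤ) * v l j := by
      rw [← sum_add_distrib]
      exact sum_congr rfl fun l _ => by ring
    rw [this]
    ring
  rw [e]
  calc |∑ l, (c l + k l) * v l j| ≤ ∑ l, |(c l + k l) * v l j| := abs_sum_le_sum_abs _ _
    _ = ∑ l, |c l + k l| * |v l j| := sum_congr rfl fun l _ => abs_mul _ _
    _ ≤ ∑ l, B * |v l j| := sum_le_sum fun l _ => by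
        refine mul_le_mul_of_nonneg_right ((abs_add_le _ _).trans ?_) (abs_nonneg _)
        rw [Nat.abs_cast]
        exact hB l
    _ = B * ∑ l, |v l j| := by rw [mul_sum]
    _ ≤ B * ∑ l, ∑ j', |v l j'| := mul_le_mul_of_nonneg_left (sum_le_sum fun l _ =>
        single_le_sum (f := fun j' => |v l j'|) (fun _ _ => abs_nonneg _) (mem_univ j)) hB0

/-! ## The theorem for systems with a dual frame -/

set_option maxHeartbeats 800000 in
/-- **Pandey–Woo, Theorem 5, for systems with a dual frame — the core statement.** For linear
forms `ψ₁, …, ψ_t` on `ℤ^d` with non-negative coefficients, none zero, a dual frame `v`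
(`ψᵢ(v_l) = δ_{il}`), an index `i₀` and `λ > 1`: the conclusion of `SmallScalePatternIrregularity`
with `δ⁺ = η₁/10`, `δ⁻ = η₂/25` (`η₁, η₂` the oscillation constants of Maier's matrix for
`A = λ + 2`). See the module docstring for the argument.
[cite: PandeyWoo2024, Theorem 5 and §2.4] [cite: Maier1985, Theorem] -/
theorem irregularity (Ψ : Fin t → AffLinForm d) (h0 : ∀ i, (Ψ i).const = 0)
    (hc : ∀ i j, 0 ≤ (Ψ i).coeff j) (hne : ∀ i, (Ψ i).coeff ≠ 0) {v : Fin t → Fin d → ℤ}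
    (hv : IsDualFrame Ψ v) (i₀ : Fin t) {lam : ℝ} (hlam : 1 < lam) :
    ∃ δp δm : ℝ, 0 < δp ∧ 0 < δm ∧ ∀ X₀ : ℕ, ∃ X : ℕ, X₀ ≤ X ∧
      (∃ x : Fin d → ℕ, (∀ j, X ≤ x j ∧ x j ≤ 2 * X) ∧
        (1 + δp) * smallScaleMainTerm Ψ lam X ≤ primePatternCount Ψ x ((Real.log X) ^ lam)) ∧
      (∃ x : Fin d → ℕ, (∀ j, X ≤ x j ∧ x j ≤ 2 * X) ∧
        (primePatternCount Ψ x ((Real.log X) ^ lam) : ℝ) ≤ (1 - δm) * smallScaleMainTerm Ψ lam X) := by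
  classical
  have hMT : ∀ X : ℕ, smallScaleMainTerm Ψ lam X = (Real.log X ^ lam) ^ d / Real.log X ^ t :=
    fun X => smallScaleMainTerm_of_frame Ψ h0 hv lam X
  have ht1 : 1 ≤ t := Nat.one_le_iff_ne_zero.2 fun h => by subst h; exact Fin.elim0 i₀
  have ht1R : (1 : ℝ) ≤ t := by exact_mod_cast ht1
  have ht0R : (0 : ℝ) < t := by linarith
  -- ### constants of the system
  set σ : Fin t → ℤ := fun i => ∑ j, (Ψ i).coeff j with hσdef
  have hσ1 : ∀ i, 1 ≤ σ i := fun i => one_le_sum_coeff (Ψ i) (hc i) (hne i)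
  have hσ1R : ∀ i, (1 : ℝ) ≤ σ i := fun i => by exact_mod_cast hσ1 i
  set c₀ : ℤ := σ i₀ with hc₀def
  have hc1 : 1 ≤ c₀ := hσ1 i₀
  have hc0 : 0 < c₀ := by omega
  have hc1R : (1 : ℝ) ≤ c₀ := by exact_mod_cast hc1
  have hc0R : (0 : ℝ) < c₀ := by linarith
  set σS : ℤ := ∑ i, σ i with hσSdef
  have hσS : ∀ i, σ i ≤ σS := fun i =>
    single_le_sum (f := σ) (fun i _ => by linarith [hσ1 i]) (mem_univ i)
  have hσSR : ∀ i, ((σ i : ℤ) : ℝ) ≤ σS := fun i => by exact_mod_cast hσS i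
  have hc₀σS : (c₀ : ℝ) ≤ σS := hσSR i₀
  have hσS1R : (1 : ℝ) ≤ σS := hc1R.trans hc₀σS
  set Vt : ℤ := ∑ l, ∑ j, |v l j| with hVtdef
  have hVt0 : 0 ≤ Vt := sum_nonneg fun l _ => sum_nonneg fun j _ => abs_nonneg _
  have hVt0R : (0 : ℝ) ≤ Vt := by exact_mod_cast hVt0
  have hc₀nat : (c₀.toNat : ℤ) = c₀ := Int.toNat_of_nonneg hc0.le
  have hVtnat : (Vt.toNat : ℤ) = Vt := Int.toNat_of_nonneg hVt0
  set Kn : ℕ := 15 * c₀.toNat * (Vt.toNat + 1) with hKndef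
  have hKnZ : (Kn : ℤ) = 15 * c₀ * (Vt + 1) := by
    rw [hKndef]; push_cast; rw [hc₀nat, hVtnat]
  have hKnR : (Kn : ℝ) = 15 * c₀ * (Vt + 1) := by exact_mod_cast hKnZ
  have hKn1R : (1 : ℝ) ≤ Kn := by rw [hKnR]; nlinarith
  have hKn0R : (0 : ℝ) < Kn := by linarith
  have hKn1 : 1 ≤ Kn := by exact_mod_cast hKn1R
  have hσi : ∀ i, ∑ j, (Ψ i).coeff j = σ i := fun i => by rw [hσdef]
  clear_value Kn Vt σS c₀ σ
  have hC₁0 : 0 ≤ Real.log (4 * c₀) := Real.log_nonneg (by linarith only [hc1R])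
  have hC₂0 : 0 ≤ Real.log (12 * c₀) := Real.log_nonneg (by linarith only [hc1R])
  have hL60 : 0 ≤ Real.log (6 * σS) := Real.log_nonneg (by linarith only [hσS1R])
  have hlog3 : 0 < Real.log 3 := Real.log_pos (by norm_num)
  have hlog2 : Real.log 2 < 1 := by linarith only [log_two_lt]
  -- ### Maier's rows
  set A : ℝ := lam + 2 with hAdef
  have hA2 : 2 < A := by rw [hAdef]; linarith only [hlam]
  have hA0 : 0 < A := by linarith only [hA2]
  have hlam1 : 0 ≤ lam + 1 := by linarith only [hlam]
  have hlam0 : 0 < lam := by linarith only [hlam]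
  set mA : ℕ := ⌈A⌉₊ with hmAdef
  have hmA : A ≤ mA := Nat.le_ceil A
  obtain ⟨η₁, hη₁0, hη₁1, hev₁⟩ := matrix_rows hA2 (k := 4 * mA + 2) (by push_cast; linarith only [hmA, hA0])
  obtain ⟨η₂, hη₂0, hη₂1, hev₂⟩ := matrix_rows hA2 (k := 4 * mA + 3) (by push_cast; linarith only [hmA, hA0])
  refine ⟨η₁ / 10, η₂ / 25, by positivity, by positivity, fun X₀ => ?_⟩
  obtain ⟨N₁, hN₁⟩ := eventually_atTop.1 hev₁
  obtain ⟨N₂, hN₂⟩ := eventually_atTop.1 hev₂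
  -- ### accuracies for the long windows
  set εp : ℝ := η₁ / (200 * t) with hεpdef
  set εm : ℝ := η₂ / (200 * t) with hεmdef
  have hεp0 : 0 < εp := by positivity
  have hεm0 : 0 < εm := by positivity
  have hεpt : (t : ℝ) * εp ≤ η₁ / 200 := by rw [hεpdef]; field_simp; nlinarith
  have hεmt : (t : ℝ) * εm ≤ η₂ / 200 := by rw [hεmdef]; field_simp; nlinarith
  have hεp1 : εp ≤ 1 := by nlinarith
  have hεm1 : εm ≤ 1 := by nlinarith
  set εmin : ℝ := min εp εm with hεmindef
  have hεmin0 : 0 < εmin := lt_min hεp0 hεm0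
  have hεminp : εmin ≤ εp := min_le_left _ _
  have hεminm : εmin ≤ εm := min_le_right _ _
  set εθ : ℝ := εmin / (8 * Kn) with hεθdef
  have hεθ0 : 0 < εθ := by positivity
  obtain ⟨N₃, hN₃⟩ := eventually_atTop.1 (eventually_theta_window (a := 1 / (4 * c₀)) (C := 4 * σS)
    (by positivity) (by linarith only [hσS1R]) hεθ0)
  -- ### the conditions on `L = log N`
  have Q1 : ∀ᶠ L : ℝ in atTop, Real.log (4 * c₀) + Real.log 3 + 2 ≤ L := eventually_ge_atTop _
  have Q2 : ∀ᶠ L : ℝ in atTop,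
      (30 * c₀ * Vt) * (L + 1) ^ A + 15 * c₀ * (c₀ * Vt + 1) ≤ Real.exp L :=
    eventually_mul_rpow_add_le_exp (by positivity) zero_le_one hA0
  have Q3 : ∀ᶠ L : ℝ in atTop, 20 * Real.log (12 * c₀) ≤ η₁ * (L - Real.log (4 * c₀)) :=
    ((tendsto_atTop_add_const_right _ _ tendsto_id).const_mul_atTop hη₁0).eventually_ge_atTop _
  have Q4 : ∀ᶠ L : ℝ in atTop, 20 * c₀ * (L + Real.log 3) ^ (lam + 1) ≤
      η₁ * ((L - (Real.log (4 * c₀) + Real.log 3)) ^ A - 1) :=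
    eventually_mul_rpow_le_rpow_sub (by positivity) hlog3.le (by positivity)
      (by rw [hAdef]; linarith only) hA0 hη₁0
  have Q5 : ∀ᶠ L : ℝ in atTop, 20 * Real.log 3 ≤ η₂ * (L - (Real.log (4 * c₀) + Real.log 3)) :=
    ((tendsto_atTop_add_const_right _ _ tendsto_id).const_mul_atTop hη₂0).eventually_ge_atTop _
  have Q6 : ∀ᶠ L : ℝ in atTop, 20 * c₀ * (L + Real.log 3) ^ (lam + 1) ≤
      η₂ * ((L - (Real.log (4 * c₀) + Real.log 3)) ^ A - 1) :=
    eventually_mul_rpow_le_rpow_sub (by positivity) hlog3.le (by positivity)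
      (by rw [hAdef]; linarith only) hA0 hη₂0
  have Q7 : ∀ᶠ L : ℝ in atTop, (1 + 1 / (L - Real.log (4 * c₀)) ^ lam) ^ d ≤ 1 + η₂ / 200 :=
    eventually_one_add_inv_rpow_pow_le hlam0 (by linarith only [hη₂0]) d
  have Q8 : ∀ᶠ L : ℝ in atTop, (8 * Kn * σS / εmin) * (L + Real.log 3) ^ (lam + 1) + 0 ≤ Real.exp L :=
    eventually_mul_rpow_add_le_exp (by positivity) hlog3.le (by linarith only [hlam0])
  have Q9 : ∀ᶠ L : ℝ in atTop, 4 * Real.log (6 * σS) ≤ εmin * (L - Real.log (4 * c₀)) :=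
    ((tendsto_atTop_add_const_right _ _ tendsto_id).const_mul_atTop hεmin0).eventually_ge_atTop _
  obtain ⟨L₀, hL₀⟩ := eventually_atTop.1
    (Q1.and (Q2.and (Q3.and (Q4.and (Q5.and (Q6.and (Q7.and (Q8.and Q9))))))))
  -- ### the scale `N`
  set N : ℕ := max (max (max N₁ (2 * N₂ + 2)) N₃)
    (max ⌈Real.exp L₀⌉₊ (max (4 * c₀.toNat * (X₀ + 2) + 6) (8 * c₀.toNat + 2 * Kn + 10))) with hNdef
  have hNN₁ : N₁ ≤ N := le_trans (le_trans (le_max_left _ _) (le_max_left _ _)) (le_max_left _ _)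
  have hNN₂ : 2 * N₂ + 2 ≤ N :=
    le_trans (le_trans (le_max_right _ _) (le_max_left _ _)) (le_max_left _ _)
  have hNN₃ : N₃ ≤ N := le_trans (le_max_right _ _) (le_max_left _ _)
  have hNexp : ⌈Real.exp L₀⌉₊ ≤ N := le_trans (le_max_left _ _) (le_max_right _ _)
  have hNX₀ : 4 * c₀.toNat * (X₀ + 2) + 6 ≤ N :=
    le_trans (le_trans (le_max_left _ _) (le_max_right _ _)) (le_max_right _ _)
  have hNK : 8 * c₀.toNat + 2 * Kn + 10 ≤ N :=
    le_trans (le_trans (le_max_right _ _) (le_max_right _ _)) (le_max_right _ _)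
  have hN6 : 6 ≤ N := by omega
  have hN0R : (0 : ℝ) < N := by exact_mod_cast (show 0 < N by omega)
  have hN6R : (6 : ℝ) ≤ N := by exact_mod_cast hN6
  have hNKR : 8 * (c₀ : ℝ) + 2 * Kn + 10 ≤ N := by
    have h1 : ((8 * c₀.toNat + 2 * Kn + 10 : ℕ) : ℤ) ≤ N := by exact_mod_cast hNK
    push_cast at h1
    rw [hc₀nat] at h1
    exact_mod_cast h1
  have hLL₀ : L₀ ≤ Real.log N := by
    have h1 : Real.exp L₀ ≤ N := (Nat.le_ceil _).trans (by exact_mod_cast hNexp)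
    have := Real.log_le_log (Real.exp_pos _) h1
    rwa [Real.log_exp] at this
  clear_value N
  obtain ⟨q1, q2, q3, q4, q5, q6, q7, q8, q9⟩ := hL₀ (Real.log N) hLL₀
  have hexpL : Real.exp (Real.log N) = N := Real.exp_log hN0R
  have hL2 : 2 ≤ Real.log N := by linarith only [q1, hC₁0, hlog3]
  have hL0 : 0 < Real.log N := by linarith only [hL2]
  -- ### the surplus row at scale `N`
  have hLA1 : 1 ≤ Real.log N ^ A := Real.one_le_rpow (by linarith only [hL2]) hA0.le
  set h₁ : ℕ := ⌊Real.log N ^ A⌋₊ with hh₁def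
  have hh₁1 : 1 ≤ h₁ := Nat.le_floor (by simpa using hLA1)
  have hh₁le : (h₁ : ℝ) ≤ Real.log N ^ A := Nat.floor_le (by positivity)
  have hh₁ge : Real.log N ^ A - 1 ≤ h₁ := (Nat.sub_one_lt_floor _).le
  have hLA' : Real.log N ^ A ≤ (Real.log N + 1) ^ A :=
    Real.rpow_le_rpow hL0.le (by linarith only) hA0.le
  have hh₁up : (h₁ : ℝ) ≤ (Real.log N + 1) ^ A + 1 := by linarith only [hh₁le, hLA']
  have hh₁pos : (0 : ℝ) < h₁ := by exact_mod_cast hh₁1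
  clear_value h₁
  obtain ⟨m, hNm, hm2N, hR₁⟩ := (hN₁ N hNN₁ h₁ hh₁1 hh₁up hh₁ge).1 ⟨2 * mA + 1, by ring⟩
  have hmR : (m : ℝ) ≤ 2 * N := by exact_mod_cast hm2N
  have hNmR : (N : ℝ) < m := by exact_mod_cast hNm
  -- ### the deficit row at the adapted scale `N' = ⌊7m/10⌋`
  set N' : ℕ := 7 * m / 10 with hN'def
  have hN'1 : 10 * N' ≤ 7 * m := by
    have : N' * 10 ≤ 7 * m := Nat.div_mul_le_self (7 * m) 10
    omega
  have hN'2 : 7 * m < 10 * N' + 10 := by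
    have : 7 * m < N' * 10 + 10 := Nat.lt_div_mul_add (by norm_num)
    omega
  have hN'N₂ : N₂ ≤ N' := by omega
  have hN'3 : 3 ≤ N' := by omega
  have hN'R3 : (3 : ℝ) ≤ N' := by exact_mod_cast hN'3
  have hN'0R : (0 : ℝ) < N' := by linarith only [hN'R3]
  have hN'R1 : 10 * (N' : ℝ) ≤ 7 * m := by exact_mod_cast hN'1
  have hN'R2 : 7 * (m : ℝ) < 10 * N' + 10 := by exact_mod_cast hN'2
  clear_value N'
  have hlog31 : (1 : ℝ) ≤ Real.log 3 := by
    rw [Real.le_log_iff_exp_le (by norm_num)]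
    linarith only [Real.exp_one_lt_d9]
  have hL'1 : 1 ≤ Real.log N' := hlog31.trans (Real.log_le_log (by norm_num) hN'R3)
  have hL'0 : 0 < Real.log N' := by linarith only [hL'1]
  have hL'L : Real.log N' ≤ Real.log N + 1 := by
    have h1 : (N' : ℝ) ≤ 2 * N := by linarith only [hN'R1, hmR]
    have := Real.log_le_log hN'0R h1
    rw [Real.log_mul two_ne_zero hN0R.ne'] at this
    linarith only [this, hlog2]
  have hL'A1 : 1 ≤ Real.log N' ^ A := Real.one_le_rpow hL'1 hA0.le
  set h₂ : ℕ := ⌊Real.log N' ^ A⌋₊ with hh₂def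
  have hh₂1 : 1 ≤ h₂ := Nat.le_floor (by simpa using hL'A1)
  have hh₂le : (h₂ : ℝ) ≤ Real.log N' ^ A := Nat.floor_le (by positivity)
  have hh₂ge : Real.log N' ^ A - 1 ≤ h₂ := (Nat.sub_one_lt_floor _).le
  have hL'A' : Real.log N' ^ A ≤ (Real.log N' + 1) ^ A :=
    Real.rpow_le_rpow hL'0.le (by linarith only) hA0.le
  have hh₂up : (h₂ : ℝ) ≤ (Real.log N' + 1) ^ A + 1 := by linarith only [hh₂le, hL'A']
  have hh₂pos : (0 : ℝ) < h₂ := by exact_mod_cast hh₂1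
  clear_value h₂
  obtain ⟨m', hN'm', hm'2N', hR₂⟩ := (hN₂ N' hN'N₂ h₂ hh₂1 hh₂up hh₂ge).2 ⟨2 * mA + 1, by ring⟩
  have hm'R : (m' : ℝ) ≤ 2 * N' := by exact_mod_cast hm'2N'
  have hN'm'R : (N' : ℝ) < m' := by exact_mod_cast hN'm'
  -- ### the long windows
  set hL : ℕ := N / Kn with hhLdef
  have hhLle : (hL : ℝ) ≤ N / Kn := Nat.cast_div_le
  have hhLge : (N : ℝ) / (2 * Kn) ≤ hL := by
    have h1 : (N : ℝ) / Kn - 1 ≤ hL := by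
      have e1 : N < N / Kn * Kn + Kn := Nat.lt_div_mul_add (by exact_mod_cast hKn1)
      have e2 : (N : ℝ) < hL * Kn + Kn := by rw [hhLdef]; exact_mod_cast e1
      rw [sub_le_iff_le_add, div_le_iff₀ hKn0R]
      linarith only [e2]
    have h2 : (1 : ℝ) ≤ N / (2 * Kn) := by
      rw [le_div_iff₀ (by positivity)]; linarith only [hNKR, hc0R]
    have h3 : (N : ℝ) / Kn = 2 * (N / (2 * Kn)) := by field_simp
    linarith only [h1, h2, h3]
  have hhLpos : (0 : ℝ) < hL := lt_of_lt_of_le (by positivity) hhLge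
  have hhL1 : 1 ≤ hL := by exact_mod_cast (show (0 : ℝ) < hL from hhLpos)
  have hhLN : (hL : ℝ) ≤ N := hhLle.trans (div_le_self hN0R.le hKn1R)
  have hKhL : (Kn : ℤ) * hL ≤ N := by
    have : Kn * hL ≤ N := by rw [hhLdef, mul_comm]; exact Nat.div_mul_le_self N Kn
    exact_mod_cast this
  clear_value hL
  -- ### the common range `[X, 2X]`
  obtain ⟨q₁, r₁, hqr₁, hr₁0, hr₁c⟩ : ∃ q r : ℤ, c₀ * q + r = m + 1 ∧ 0 ≤ r ∧ r < c₀ :=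
    ⟨((m : ℤ) + 1) / c₀, ((m : ℤ) + 1) % c₀, by linarith only [Int.emod_add_mul_ediv ((m : ℤ) + 1) c₀],
      Int.emod_nonneg _ hc0.ne', Int.emod_lt_of_pos _ hc0⟩
  obtain ⟨q₂, r₂, hqr₂, hr₂0, hr₂c⟩ : ∃ q r : ℤ, c₀ * q + r = m' + 1 ∧ 0 ≤ r ∧ r < c₀ :=
    ⟨((m' : ℤ) + 1) / c₀, ((m' : ℤ) + 1) % c₀, by linarith only [Int.emod_add_mul_ediv ((m' : ℤ) + 1) c₀],
      Int.emod_nonneg _ hc0.ne', Int.emod_lt_of_pos _ hc0⟩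
  have hq₁ : c₀ * q₁ ≤ m + 1 ∧ (m : ℤ) + 1 < c₀ * (q₁ + 1) := by
    constructor <;> linarith only [hqr₁, hr₁0, hr₁c]
  have hq₂ : c₀ * q₂ ≤ m' + 1 ∧ (m' : ℤ) + 1 < c₀ * (q₂ + 1) := by
    constructor <;> linarith only [hqr₂, hr₂0, hr₂c]
  set E : ℤ := (c₀ + h₁ + h₂ + hL) * Vt with hEdef
  have hE0 : 0 ≤ E := by positivity
  clear_value E
  have hh₁le' : (h₁ : ℝ) ≤ (Real.log N + 1) ^ A := hh₁le.trans hLA'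
  have hh₂le' : (h₂ : ℝ) ≤ (Real.log N + 1) ^ A :=
    hh₂le.trans (Real.rpow_le_rpow hL'0.le hL'L hA0.le)
  have hG : 15 * c₀ * E + 15 * c₀ ≤ 2 * (N : ℤ) := by
    -- polylogarithmic part
    have h15 : (0 : ℝ) ≤ 15 * c₀ := by positivity
    have hpoly : (15 * c₀ * ((c₀ + h₁ + h₂) * Vt) + 15 * c₀ : ℝ) ≤ N :=
      calc (15 * c₀ * ((c₀ + h₁ + h₂) * Vt) + 15 * c₀ : ℝ)
          ≤ 15 * c₀ * ((c₀ + 2 * (Real.log N + 1) ^ A) * Vt) + 15 * c₀ := by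
            have : ((c₀ : ℝ) + h₁ + h₂) * Vt ≤ (c₀ + 2 * (Real.log N + 1) ^ A) * Vt :=
              mul_le_mul_of_nonneg_right (by linarith only [hh₁le', hh₂le']) hVt0R
            nlinarith only [this, h15]
        _ = (30 * c₀ * Vt) * (Real.log N + 1) ^ A + 15 * c₀ * (c₀ * Vt + 1) := by ring
        _ ≤ Real.exp (Real.log N) := q2
        _ = N := hexpL
    have hpolyZ : 15 * c₀ * ((c₀ + h₁ + h₂) * Vt) + 15 * c₀ ≤ (N : ℤ) := by exact_mod_cast hpoly
    -- the long-window part: `15 c₀ Vt hL ≤ Kn hL ≤ N`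
    have hlong : 15 * c₀ * (hL * Vt) ≤ (N : ℤ) := by
      have : 15 * c₀ * ((hL : ℤ) * Vt) ≤ (Kn : ℤ) * hL := by
        rw [hKnZ]; nlinarith only [hVt0, hc0, (show (0 : ℤ) ≤ hL by positivity)]
      exact this.trans hKhL
    rw [hEdef]; nlinarith only [hpolyZ, hlong]
  obtain ⟨ho1, ho2, ho3, ho4, ho5, ho6⟩ := corner_geometry hc1
    (show (N : ℤ) < m by exact_mod_cast hNm) (show (m : ℤ) ≤ 2 * N by exact_mod_cast hm2N)
    (show 10 * (N' : ℤ) ≤ 7 * m by exact_mod_cast hN'1)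
    (show 7 * (m : ℤ) < 10 * N' + 10 by exact_mod_cast hN'2)
    (show (N' : ℤ) < m' by exact_mod_cast hN'm') (show (m' : ℤ) ≤ 2 * N' by exact_mod_cast hm'2N')
    hq₁.1 hq₁.2 hq₂.1 hq₂.2 hE0 hG
  set Xz : ℤ := min q₁ q₂ - E with hXzdef
  set X : ℕ := Xz.toNat with hXdef
  have hXXz : (X : ℤ) = Xz := Int.toNat_of_nonneg ho6
  clear_value X Xz
  have hXR : (X : ℝ) = (Xz : ℝ) := by exact_mod_cast hXXz
  have hX₀2 : (X₀ : ℤ) + 2 ≤ Xz := by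
    have h1 : ((4 * c₀.toNat * (X₀ + 2) + 6 : ℕ) : ℤ) ≤ N := by exact_mod_cast hNX₀
    push_cast at h1
    rw [hc₀nat] at h1
    have h3 : 4 * c₀ * ((X₀ : ℤ) + 2) < 4 * c₀ * Xz := by linarith only [h1, ho3]
    exact (lt_of_mul_lt_mul_left h3 (by positivity)).le
  have hX₀X : X₀ ≤ X := by
    have : (X₀ : ℤ) ≤ X := by rw [hXXz]; linarith only [hX₀2]
    exact_mod_cast this
  have hX2R : (2 : ℝ) ≤ X := by
    have : (2 : ℤ) ≤ X := by rw [hXXz]; linarith only [hX₀2]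
    exact_mod_cast this
  have hX0R : (0 : ℝ) < X := by linarith only [hX2R]
  have hXq₁ : (X : ℝ) ≤ q₁ := by
    have : Xz ≤ q₁ := by rw [hXzdef]; linarith only [min_le_left q₁ q₂, hE0]
    rw [hXR]; exact_mod_cast this
  have hXq₂ : (X : ℝ) ≤ q₂ := by
    have : Xz ≤ q₂ := by rw [hXzdef]; linarith only [min_le_right q₁ q₂, hE0]
    rw [hXR]; exact_mod_cast this
  have hq₁X : (q₁ : ℝ) ≤ 2 * X := by
    have : q₁ ≤ 2 * Xz := by linarith only [ho1, hE0]
    rw [hXR]; exact_mod_cast this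
  have hq₂X : (q₂ : ℝ) ≤ 2 * X := by
    have : q₂ ≤ 2 * Xz := by linarith only [ho2, hE0]
    rw [hXR]; exact_mod_cast this
  have hq₁pos : (0 : ℝ) < q₁ := hX0R.trans_le hXq₁
  have hq₂pos : (0 : ℝ) < q₂ := hX0R.trans_le hXq₂
  have ho3R : (N : ℝ) ≤ 4 * c₀ * X := by rw [hXR]; exact_mod_cast ho3
  have ho4R : (X : ℝ) ≤ 3 * N := by rw [hXR]; exact_mod_cast ho4
  have ho5R : (X : ℝ) ≤ 3 * N' := by rw [hXR]; exact_mod_cast ho5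
  have hℓpos : 0 < Real.log X := Real.log_pos (by linarith only [hX2R])
  have hR1 : Real.log N - Real.log (4 * c₀) ≤ Real.log X := by
    have := Real.log_le_log hN0R ho3R
    rw [Real.log_mul (by positivity) hX0R.ne'] at this
    linarith only [this]
  have hR2 : Real.log X ≤ Real.log N + Real.log 3 := by
    have := Real.log_le_log hX0R ho4R
    rw [Real.log_mul (by norm_num) hN0R.ne'] at this
    linarith only [this]
  have hR3 : Real.log (3 * N) ≤ Real.log X + Real.log (12 * c₀) := by
    have := Real.log_le_log (by positivity) (show (3 : ℝ) * N ≤ 12 * c₀ * X by linarith only [ho3R])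
    rw [Real.log_mul (by positivity) hX0R.ne'] at this
    linarith only [this]
  have hR4 : Real.log X - Real.log 3 ≤ Real.log N' := by
    have := Real.log_le_log hX0R ho5R
    rw [Real.log_mul (by norm_num) hN'0R.ne'] at this
    linarith only [this]
  have hℓ2 : 2 ≤ Real.log X := by linarith only [hR1, q1, hlog3]
  -- ### the boxes: common data
  set Hn : ℕ := ⌊Real.log X ^ lam⌋₊ with hHndef
  have hHpos : 0 < Real.log X ^ lam := Real.rpow_pos_of_pos hℓpos lam
  have hHnle : (Hn : ℝ) ≤ Real.log X ^ lam := Nat.floor_le hHpos.le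
  have hHnge : Real.log X ^ lam ≤ (Hn : ℝ) + 1 := (Nat.lt_floor_add_one _).le
  have hHd1 : (Real.log X ^ lam) ^ d ≤ ((Hn : ℝ) + 1) ^ d := pow_le_pow_left₀ hHpos.le hHnge d
  set U : Finset (Fin d → ℕ) := Fintype.piFinset fun _ : Fin d => range (Hn + 1) with hUdef
  have hUcard : (#U : ℝ) = ((Hn : ℝ) + 1) ^ d := by
    rw [hUdef, Fintype.card_piFinset, prod_const, card_range, card_univ, Fintype.card_fin]
    push_cast; ring
  have hpoly : 20 * c₀ * (Real.log X ^ lam * Real.log X) ≤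
      20 * c₀ * (Real.log N + Real.log 3) ^ (lam + 1) := by
    rw [← Real.rpow_add_one hℓpos.ne' lam]
    exact mul_le_mul_of_nonneg_left (Real.rpow_le_rpow hℓpos.le hR2 hlam1) (by positivity)
  have hbase0 : 0 ≤ Real.log N - (Real.log (4 * c₀) + Real.log 3) := by linarith only [q1]
  have hbaseA : (Real.log N - (Real.log (4 * c₀) + Real.log 3)) ^ A ≤ Real.log N ^ A :=
    Real.rpow_le_rpow hbase0 (by linarith only [hC₁0, hlog3]) hA0.le
  have hbaseA' : (Real.log N - (Real.log (4 * c₀) + Real.log 3)) ^ A ≤ Real.log N' ^ A :=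
    Real.rpow_le_rpow hbase0 (by linarith only [hR1, hR4]) hA0.le
  -- the shift error of the long windows: `σS (log X)^λ · log X ≤ (εmin/4) hL`
  have hshift : (σS : ℝ) * Real.log X ^ lam * Real.log X ≤ εmin / 4 * hL := by
    have h1 : (σS : ℝ) * (Real.log X ^ lam * Real.log X) ≤ σS * (Real.log N + Real.log 3) ^ (lam + 1) := by
      rw [← Real.rpow_add_one hℓpos.ne' lam]
      exact mul_le_mul_of_nonneg_left (Real.rpow_le_rpow hℓpos.le hR2 hlam1) (by positivity)
    have h2 : (8 * Kn * σS / εmin) * (Real.log N + Real.log 3) ^ (lam + 1) ≤ N := by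
      have := q8; rw [add_zero, hexpL] at this; exact this
    have h3 : (σS : ℝ) * (Real.log N + Real.log 3) ^ (lam + 1) ≤ εmin / (8 * Kn) * N := by
      have h8 : (0 : ℝ) < 8 * Kn * σS / εmin := by positivity
      have : (σS : ℝ) * (Real.log N + Real.log 3) ^ (lam + 1) =
          εmin / (8 * Kn) * ((8 * Kn * σS / εmin) * (Real.log N + Real.log 3) ^ (lam + 1)) := by
        field_simp
      rw [this]
      exact mul_le_mul_of_nonneg_left h2 (by positivity)
    calc (σS : ℝ) * Real.log X ^ lam * Real.log X = σS * (Real.log X ^ lam * Real.log X) := by ring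
      _ ≤ εmin / (8 * Kn) * N := h1.trans h3
      _ = εmin / 4 * (N / (2 * Kn)) := by field_simp; ring
      _ ≤ εmin / 4 * hL := mul_le_mul_of_nonneg_left hhLge (by positivity)
  -- the PNT error of the long windows: `εθ N ≤ (εmin/4) hL`
  have hEθ : εθ * N ≤ εmin / 4 * hL := by
    calc εθ * N = εmin / 4 * (N / (2 * Kn)) := by rw [hεθdef]; field_simp; ring
      _ ≤ εmin / 4 * hL := mul_le_mul_of_nonneg_left hhLge (by positivity)
  have hℓbig : 4 * Real.log (6 * σS) ≤ εmin * Real.log X :=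
    q9.trans (mul_le_mul_of_nonneg_left hR1 hεmin0.le)
  -- `log(σ_i q − 1 + hL) ≤ log X + log(6 σS)` for `q ≤ 2X`
  have hLup : ∀ (i : Fin t) (q : ℤ), (0 : ℝ) ≤ q → (q : ℝ) ≤ 2 * X → (0 : ℝ) < σ i * q - 1 + hL →
      Real.log ((σ i : ℝ) * q - 1 + hL) ≤ Real.log X + Real.log (6 * σS) := by
    intro i q hq0 hq hpos
    have e1 : ((σ i : ℤ) : ℝ) * q ≤ σS * q := mul_le_mul_of_nonneg_right (hσSR i) hq0
    have e2 : (σS : ℝ) * q ≤ σS * (2 * X) := mul_le_mul_of_nonneg_left hq (by linarith only [hσS1R])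
    have e3 : 4 * (c₀ : ℝ) * X ≤ 4 * σS * X := by
      have := mul_le_mul_of_nonneg_right hc₀σS hX0R.le
      linarith only [this]
    have h1 : ((σ i : ℤ) : ℝ) * q - 1 + hL ≤ 6 * σS * X := by
      linarith only [e1, e2, e3, hhLN, ho3R]
    have h6 : (0 : ℝ) < 6 * σS := by linarith only [hσS1R]
    have h7 := Real.log_le_log hpos h1
    rw [Real.log_mul h6.ne' hX0R.ne'] at h7
    linarith only [h7]
  -- integer lower bounds for `q₁`, `q₂`: `N + 4c₀ ≤ 4c₀ qᵢ`
  have hNK8 : 8 * c₀ ≤ (N : ℤ) := by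
    have h1 : ((8 * c₀.toNat + 2 * Kn + 10 : ℕ) : ℤ) ≤ N := by exact_mod_cast hNK
    push_cast at h1; rw [hc₀nat] at h1; linarith only [h1]
  have hq₁low : (N : ℤ) + 4 * c₀ ≤ 4 * c₀ * q₁ := by
    have e1 : (N : ℤ) + 1 ≤ m := by exact_mod_cast hNm
    linarith only [hq₁.2, e1, hNK8]
  have hq₂low : (N : ℤ) + 4 * c₀ ≤ 4 * c₀ * q₂ := by
    have e1 : (N : ℤ) + 1 ≤ m := by exact_mod_cast hNm
    have e2 : (N' : ℤ) + 1 ≤ m' := by exact_mod_cast hN'm'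
    have e3 : 7 * (m : ℤ) < 10 * N' + 10 := by exact_mod_cast hN'2
    linarith only [hq₂.2, e1, e2, e3, hNK8]
  have hq₁lowR : (N : ℝ) + 4 * c₀ ≤ 4 * c₀ * q₁ := by exact_mod_cast hq₁low
  have hq₂lowR : (N : ℝ) + 4 * c₀ ≤ 4 * c₀ * q₂ := by exact_mod_cast hq₂low
  have hq₁upR : (q₁ : ℝ) ≤ 2 * N + 1 := by
    have e1 : c₀ * q₁ ≤ (m : ℤ) + 1 := hq₁.1
    have e2 : q₁ ≤ c₀ * q₁ := le_mul_of_one_le_left (by exact_mod_cast hq₁pos.le) hc1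
    have e3 : (q₁ : ℤ) ≤ 2 * N + 1 := by linarith only [e1, e2, (show (m : ℤ) ≤ 2 * N by exact_mod_cast hm2N)]
    exact_mod_cast e3
  have hq₂upR : (q₂ : ℝ) ≤ 3 * N := by
    have e1 : c₀ * q₂ ≤ (m' : ℤ) + 1 := hq₂.1
    have e2 : q₂ ≤ c₀ * q₂ := le_mul_of_one_le_left (by exact_mod_cast hq₂pos.le) hc1
    have e4 : (m' : ℤ) ≤ 2 * N' := by exact_mod_cast hm'2N'
    have e5 : 10 * (N' : ℤ) ≤ 7 * m := by exact_mod_cast hN'1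
    have e6 : (m : ℤ) ≤ 2 * N := by exact_mod_cast hm2N
    have e7 : (6 : ℤ) ≤ N := by exact_mod_cast hN6
    have e3 : (q₂ : ℤ) ≤ 3 * N := by linarith only [e1, e2, e4, e5, e6, e7]
    exact_mod_cast e3
  -- the long-window prime counts at a base `q ∈ {q₁, q₂}`: PNT bounds
  have hPNT : ∀ (i : Fin t) (q : ℤ), (N : ℝ) + 4 * c₀ ≤ 4 * c₀ * q → (q : ℝ) ≤ 3 * N →
      ∀ mv : ℕ, ((mv : ℕ) : ℝ) = σ i * q - 1 →
      |Chebyshev.theta ((mv + hL : ℕ) : ℝ) - Chebyshev.theta (mv : ℝ) - hL| ≤ εθ * N := by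
    intro i q hql hqu mv hmv
    refine hN₃ N hNN₃ mv hL ?_ ?_
    · rw [hmv]
      have e1 : (q : ℝ) ≤ σ i * q := le_mul_of_one_le_left (by nlinarith only [hql, hc0R, hN0R]) (hσ1R i)
      have e2 : 1 / (4 * (c₀ : ℝ)) * N = N / (4 * c₀) := by ring
      rw [e2, div_le_iff₀ (by positivity)]
      nlinarith only [hql, e1, hc0R]
    · rw [hmv]
      have hq0 : (0 : ℝ) ≤ q := by nlinarith only [hql, hc0R, hN0R]
      have e1 : ((σ i : ℤ) : ℝ) * q ≤ σS * q := mul_le_mul_of_nonneg_right (hσSR i) hq0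
      have e2 : (σS : ℝ) * q ≤ σS * (3 * N) := mul_le_mul_of_nonneg_left hqu (by linarith only [hσS1R])
      have e3 : (N : ℝ) ≤ σS * N := le_mul_of_one_le_left hN0R.le hσS1R
      linarith only [e1, e2, e3, hhLN]
  -- ### the surplus box
  set cf₁ : Fin t → ℤ := fun l => if l = i₀ then r₁ else 0 with hcf₁
  set mv₁ : Fin t → ℕ := fun i => if i = i₀ then m else (σ i * q₁ - 1).toNat with hmv₁
  set hw₁ : Fin t → ℕ := fun i => if i = i₀ then h₁ else hL with hhw₁
  have hcf₁i₀ : cf₁ i₀ = r₁ := by simp [hcf₁]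
  have hcf₁i : ∀ l, l ≠ i₀ → cf₁ l = 0 := fun l hl => by simp [hcf₁, hl]
  have hcf₁abs : ∀ l, |cf₁ l| ≤ c₀ := by
    intro l
    by_cases hl : l = i₀
    · rw [hl, hcf₁i₀, abs_of_nonneg hr₁0]; exact hr₁c.le
    · rw [hcf₁i l hl, abs_zero]; exact hc0.le
  have hmv₁i₀ : mv₁ i₀ = m := by simp [hmv₁]
  have hmv₁Z : ∀ i, i ≠ i₀ → ((mv₁ i : ℕ) : ℤ) = σ i * q₁ - 1 := by
    intro i hi
    simp only [hmv₁, if_neg hi]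
    have hq1 : (1 : ℤ) ≤ q₁ := by
      have : (1 : ℝ) ≤ q₁ := by linarith only [hXq₁, hX2R]
      exact_mod_cast this
    exact Int.toNat_of_nonneg (by nlinarith only [hσ1 i, hq1])
  have hmv₁R : ∀ i, i ≠ i₀ → ((mv₁ i : ℕ) : ℝ) = σ i * q₁ - 1 := fun i hi => by
    exact_mod_cast hmv₁Z i hi
  have hhw₁i₀ : hw₁ i₀ = h₁ := by simp [hhw₁]
  have hhw₁i : ∀ i, i ≠ i₀ → hw₁ i = hL := fun i hi => by simp [hhw₁, hi]
  have hhw₁pos : ∀ i, 1 ≤ hw₁ i := by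
    intro i; by_cases hi : i = i₀
    · rw [hi, hhw₁i₀]; exact hh₁1
    · rw [hhw₁i i hi]; exact hhL1
  have hhw₁le : ∀ i, hw₁ i ≤ h₁ + hL := by
    intro i; by_cases hi : i = i₀
    · rw [hi, hhw₁i₀]; exact Nat.le_add_right _ _
    · rw [hhw₁i i hi]; exact Nat.le_add_left _ _
  clear_value cf₁ mv₁ hw₁
  set b₁ : Fin d → ℤ := fun j => q₁ + ∑ l, cf₁ l * v l j with hb₁
  have hb₁eval : ∀ i, (Ψ i).eval b₁ = mv₁ i + 1 := by
    intro i
    rw [hb₁, eval_base Ψ h0 hv q₁ cf₁ i, hσi]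
    by_cases hi : i = i₀
    · rw [hi, hcf₁i₀, hmv₁i₀, ← hc₀def, hqr₁]
    · rw [hcf₁i i hi, hmv₁Z i hi]; ring
  -- the walk and the pigeonhole
  set K₁ := Fintype.piFinset (fun i => range (hw₁ i)) with hK₁def
  have hK₁ne : K₁.Nonempty :=
    Fintype.piFinset_nonempty.2 fun i => nonempty_range_iff.2 (by have := hhw₁pos i; omega)
  have hK₁card : (#K₁ : ℝ) = ∏ i, (hw₁ i : ℝ) := by
    rw [hK₁def, Fintype.card_piFinset]; push_cast; simp
  have hlow := le_walk_sum Ψ h0 hc hv b₁ mv₁ hb₁eval hw₁ Hn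
  obtain ⟨k, hk, hkmax⟩ := exists_sum_le_card_mul hK₁ne (fun k => #{u ∈ U |
    ∀ i, ((Ψ i).eval ((fun j => b₁ j + ∑ l, (k l : ℤ) * v l j) + fun j => (u j : ℤ))).toNat.Prime})
  have hmain := hlow.trans hkmax
  -- the prime counts of the windows and the factors
  set Rf : Fin t → ℕ := fun i => #{κ ∈ range (hw₁ i) | (mv₁ i + (κ + 1)).Prime} with hRfdef
  set Cf : Fin t → ℕ := fun i => (σ i).toNat * Hn with hCfdef
  have hCfR : ∀ i, ((Cf i : ℕ) : ℝ) = σ i * Hn := by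
    intro i
    have : ((σ i).toNat : ℤ) = σ i := Int.toNat_of_nonneg (by linarith only [hσ1 i])
    rw [hCfdef]; push_cast; rw [← this]; norm_cast
  have hRf₀ : Rf i₀ = #{κ ∈ range h₁ | (m + (κ + 1)).Prime} := by
    rw [hRfdef]; simp only [hhw₁i₀, hmv₁i₀]
  set f : Fin t → ℝ := fun i => ((Rf i : ℝ) - σ i * Hn) / hw₁ i with hfdef
  -- the distinguished factor: Maier's surplus row
  have hf₀ : (1 + η₁ / 8) / Real.log X ≤ f i₀ := by
    have hA2' : 20 * ((c₀ : ℝ) * Hn) * Real.log X ≤ η₁ * h₁ :=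
      calc 20 * ((c₀ : ℝ) * Hn) * Real.log X = 20 * c₀ * (Hn * Real.log X) := by ring
        _ ≤ 20 * c₀ * (Real.log X ^ lam * Real.log X) := by gcongr
        _ ≤ 20 * c₀ * (Real.log N + Real.log 3) ^ (lam + 1) := hpoly
        _ ≤ η₁ * ((Real.log N - (Real.log (4 * c₀) + Real.log 3)) ^ A - 1) := q4
        _ ≤ η₁ * (Real.log N ^ A - 1) :=
            mul_le_mul_of_nonneg_left (by linarith only [hbaseA]) hη₁0.le
        _ ≤ η₁ * h₁ := mul_le_mul_of_nonneg_left hh₁ge hη₁0.le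
    have key := surplus_endgame (c₀ := (c₀ : ℝ)) (H' := (Hn : ℝ)) (Hd := 1) (Hd1 := 1)
      (R := (Rf i₀ : ℝ)) (cnt := ((Rf i₀ : ℝ) - c₀ * Hn) / h₁) hη₁0 hη₁1 hℓpos hh₁pos
      zero_le_one le_rfl hC₂0 (Real.log_pos (by linarith only [hN6R])) hR3 (by rw [hRf₀]; exact hR₁)
      (q3.trans (mul_le_mul_of_nonneg_left hR1 hη₁0.le)) hA2'
      (by rw [one_mul, mul_div_cancel₀ _ hh₁pos.ne'])
    rw [hfdef]
    simp only [hhw₁i₀, ← hc₀def]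
    rw [one_div, ← div_eq_mul_inv] at key
    exact key
  -- the other factors: long windows
  have hf : ∀ i, i ≠ i₀ → (1 - εp) / Real.log X ≤ f i := by
    intro i hi
    have hmv := hmv₁R i hi
    have hposarg : (0 : ℝ) < σ i * q₁ - 1 + hL := by
      have : (1 : ℝ) ≤ σ i * q₁ := by nlinarith only [hσ1R i, hXq₁, hX2R]
      linarith only [this, hhLpos]
    have hθ := hPNT i q₁ hq₁lowR (by linarith only [hq₁upR, hN6R]) (mv₁ i) hmv
    rw [abs_le] at hθ
    have hup := theta_window_le_card_mul_log (mv₁ i) hL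
    rw [hfdef]
    simp only [hhw₁i i hi]
    refine long_factor_lower (Lc := Real.log (6 * σS)) (Lup := Real.log ((mv₁ i : ℝ) + hL))
      (θd := Chebyshev.theta ((mv₁ i + hL : ℕ) : ℝ) - Chebyshev.theta (mv₁ i : ℝ)) (E := εθ * N)
      hℓpos hhLpos hεp0 hεp1 hL60 ?_ ?_ (by linarith only [hθ.1]) ?_
      (hEθ.trans (mul_le_mul_of_nonneg_right (by linarith only [hεminp]) hhLpos.le)) ?_
      (hℓbig.trans (mul_le_mul_of_nonneg_right hεminp hℓpos.le))
    · rw [hmv]; exact Real.log_pos (by linarith only [hposarg, hXq₁, hX2R, hσ1R i,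
        (show (1 : ℝ) * q₁ ≤ σ i * q₁ from mul_le_mul_of_nonneg_right (hσ1R i) hq₁pos.le), hhLpos])
    · rw [hmv, show (σ i : ℝ) * q₁ - 1 + hL = σ i * q₁ - 1 + hL from rfl]
      exact hLup i q₁ hq₁pos.le hq₁X hposarg
    · simpa [hRfdef, hhw₁i i hi] using hup
    · calc (σ i : ℝ) * Hn * Real.log X ≤ σS * Real.log X ^ lam * Real.log X :=
            mul_le_mul_of_nonneg_right (mul_le_mul (hσSR i) hHnle (Nat.cast_nonneg _)
              (by linarith only [hσS1R])) hℓpos.le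
        _ ≤ εmin / 4 * hL := hshift
        _ ≤ εp / 4 * hL := mul_le_mul_of_nonneg_right (by linarith only [hεminp]) hhLpos.le
  -- positivity of the factors; the walk bound in `ℝ`
  have hεp1' : εp < 1 := by nlinarith only [hεpt, ht1R, hη₁1, hεp0]
  have hfpos : ∀ i, 0 < f i := by
    intro i
    by_cases hi : i = i₀
    · rw [hi]; exact lt_of_lt_of_le (by positivity) hf₀
    · exact lt_of_lt_of_le (div_pos (by linarith only [hεp1']) hℓpos) (hf i hi)
  have hCR : ∀ i, Cf i ≤ Rf i := by
    intro i
    have h1 : 0 < f i := hfpos i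
    rw [hfdef] at h1
    have hw0 : (0 : ℝ) < hw₁ i := by exact_mod_cast hhw₁pos i
    have h2 : (0 : ℝ) < (Rf i : ℝ) - σ i * Hn := (div_pos_iff_of_pos_right hw0).1 h1
    have h3 : ((Cf i : ℕ) : ℝ) < Rf i := by rw [hCfR]; linarith only [h2]
    exact_mod_cast h3.le
  -- the corner
  set z₁ : Fin d → ℤ := fun j => b₁ j + ∑ l, (k l : ℤ) * v l j with hz₁
  have hkle : ∀ l, k l < hw₁ l := fun l => mem_range.1 (Fintype.mem_piFinset.1 hk l)
  have hh₂0 : (0 : ℤ) ≤ h₂ := by positivity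
  have hz₁X : ∀ j, Xz ≤ z₁ j ∧ z₁ j ≤ 2 * Xz := by
    intro j
    have hB : ∀ l, |cf₁ l| + (k l : ℤ) ≤ c₀ + h₁ + hL := fun l => by
      have e1 := hcf₁abs l
      have e2 : ((k l : ℕ) : ℤ) ≤ h₁ + hL := by exact_mod_cast (hkle l).le.trans (hhw₁le l)
      linarith only [e1, e2]
    have hab := abs_corner_sub_le' v q₁ cf₁ k (by positivity) hB j
    rw [← hVtdef] at hab
    have hE₁ : (c₀ + h₁ + hL) * Vt ≤ E := by
      rw [hEdef]; exact mul_le_mul_of_nonneg_right (by linarith only [hh₂0]) hVt0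
    have hab' := abs_le.1 (hab.trans hE₁)
    have hzj : z₁ j = (q₁ + ∑ l, cf₁ l * v l j) + ∑ l, (k l : ℤ) * v l j := by rw [hz₁]
    constructor
    · rw [hXzdef, hzj]; linarith only [hab'.1, min_le_left q₁ q₂]
    · rw [hzj]; linarith only [hab'.2, ho1]
  have hz₁0 : ∀ j, 0 ≤ z₁ j := fun j => ho6.trans (hz₁X j).1
  have hcorn₁ : ∀ j, X ≤ (z₁ j).toNat ∧ (z₁ j).toNat ≤ 2 * X := fun j =>
    ⟨(Int.le_toNat (hz₁0 j)).2 (by rw [hXXz]; exact (hz₁X j).1),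
      Int.toNat_le.2 (by push_cast; rw [hXXz]; exact (hz₁X j).2)⟩
  have hsurplus : ∃ x : Fin d → ℕ, (∀ j, X ≤ x j ∧ x j ≤ 2 * X) ∧
      (1 + η₁ / 10) * smallScaleMainTerm Ψ lam X ≤ primePatternCount Ψ x (Real.log X ^ lam) := by
    refine ⟨fun j => (z₁ j).toNat, hcorn₁, ?_⟩
    rw [Frame.primePatternCount_eq_card Ψ hz₁0 (Real.log X ^ lam), hMT X]
    refine frame_surplus_final i₀ hη₁0 hη₁1 hℓpos (by positivity) hHd1 hεp0.le hεpt hf₀ hf ?_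
    -- the walk bound, cast to `ℝ`
    have hmain' : #U * ∏ i, (Rf i - Cf i) ≤ #K₁ * #{u ∈ U |
        ∀ i, ((Ψ i).eval (z₁ + fun j => (u j : ℤ))).toNat.Prime} := by
      have := hmain
      simp only [hσi] at this
      exact this
    have h2 := (Nat.cast_le (α := ℝ)).2 hmain'
    rw [Nat.cast_mul, Nat.cast_mul, Nat.cast_prod] at h2
    have h3 : ∏ i, (((Rf i - Cf i : ℕ)) : ℝ) = ∏ i, ((Rf i : ℝ) - σ i * Hn) :=
      prod_congr rfl fun i _ => by rw [Nat.cast_sub (hCR i), hCfR]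
    rw [h3, hUcard, hK₁card] at h2
    have hprodf : ∏ i, f i = (∏ i, ((Rf i : ℝ) - σ i * Hn)) / ∏ i, (hw₁ i : ℝ) := by
      rw [hfdef, ← prod_div_distrib]
    have hWpos : (0 : ℝ) < ∏ i, (hw₁ i : ℝ) := prod_pos fun i _ => by exact_mod_cast hhw₁pos i
    rw [hprodf, mul_div_assoc', div_le_iff₀ hWpos]
    linarith only [h2]
  -- ### the deficit box
  set cf₂ : Fin t → ℤ := fun l => if l = i₀ then r₂ else 0 with hcf₂
  set mv₂ : Fin t → ℕ := fun i => if i = i₀ then m' else (σ i * q₂ - 1).toNat with hmv₂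
  set hw₂ : Fin t → ℕ := fun i => if i = i₀ then h₂ else hL with hhw₂
  have hcf₂i₀ : cf₂ i₀ = r₂ := by simp [hcf₂]
  have hcf₂i : ∀ l, l ≠ i₀ → cf₂ l = 0 := fun l hl => by simp [hcf₂, hl]
  have hcf₂abs : ∀ l, |cf₂ l| ≤ c₀ := by
    intro l
    by_cases hl : l = i₀
    · rw [hl, hcf₂i₀, abs_of_nonneg hr₂0]; exact hr₂c.le
    · rw [hcf₂i l hl, abs_zero]; exact hc0.le
  have hmv₂i₀ : mv₂ i₀ = m' := by simp [hmv₂]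
  have hmv₂Z : ∀ i, i ≠ i₀ → ((mv₂ i : ℕ) : ℤ) = σ i * q₂ - 1 := by
    intro i hi
    simp only [hmv₂, if_neg hi]
    have hq1 : (1 : ℤ) ≤ q₂ := by
      have : (1 : ℝ) ≤ q₂ := by linarith only [hXq₂, hX2R]
      exact_mod_cast this
    exact Int.toNat_of_nonneg (by nlinarith only [hσ1 i, hq1])
  have hmv₂R : ∀ i, i ≠ i₀ → ((mv₂ i : ℕ) : ℝ) = σ i * q₂ - 1 := fun i hi => by
    exact_mod_cast hmv₂Z i hi
  have hhw₂i₀ : hw₂ i₀ = h₂ := by simp [hhw₂]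
  have hhw₂i : ∀ i, i ≠ i₀ → hw₂ i = hL := fun i hi => by simp [hhw₂, hi]
  have hhw₂pos : ∀ i, 1 ≤ hw₂ i := by
    intro i; by_cases hi : i = i₀
    · rw [hi, hhw₂i₀]; exact hh₂1
    · rw [hhw₂i i hi]; exact hhL1
  have hhw₂le : ∀ i, hw₂ i ≤ h₂ + hL := by
    intro i; by_cases hi : i = i₀
    · rw [hi, hhw₂i₀]; exact Nat.le_add_right _ _
    · rw [hhw₂i i hi]; exact Nat.le_add_left _ _
  clear_value cf₂ mv₂ hw₂
  set b₂ : Fin d → ℤ := fun j => q₂ + ∑ l, cf₂ l * v l j with hb₂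
  have hb₂eval : ∀ i, (Ψ i).eval b₂ = mv₂ i + 1 := by
    intro i
    rw [hb₂, eval_base Ψ h0 hv q₂ cf₂ i, hσi]
    by_cases hi : i = i₀
    · rw [hi, hcf₂i₀, hmv₂i₀, ← hc₀def, hqr₂]
    · rw [hcf₂i i hi, hmv₂Z i hi]; ring
  -- the walk and the pigeonhole
  set K₂ := Fintype.piFinset (fun i => range (hw₂ i)) with hK₂def
  have hK₂ne : K₂.Nonempty :=
    Fintype.piFinset_nonempty.2 fun i => nonempty_range_iff.2 (by have := hhw₂pos i; omega)
  have hK₂card : (#K₂ : ℝ) = ∏ i, (hw₂ i : ℝ) := by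
    rw [hK₂def, Fintype.card_piFinset]; push_cast; simp
  have hupw := walk_sum_le Ψ h0 hc hv b₂ mv₂ hb₂eval hw₂ Hn
  obtain ⟨k', hk', hk'min⟩ := exists_card_mul_le_sum hK₂ne (fun k => #{u ∈ U |
    ∀ i, ((Ψ i).eval ((fun j => b₂ j + ∑ l, (k l : ℤ) * v l j) + fun j => (u j : ℤ))).toNat.Prime})
  have hmain₂ := hk'min.trans hupw
  -- the prime counts of the windows and the factors
  set Rg : Fin t → ℕ := fun i => #{κ ∈ range (hw₂ i) | (mv₂ i + (κ + 1)).Prime} with hRgdef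
  have hRg₀ : Rg i₀ = #{κ ∈ range h₂ | (m' + (κ + 1)).Prime} := by
    rw [hRgdef]; simp only [hhw₂i₀, hmv₂i₀]
  set g : Fin t → ℝ := fun i => ((Rg i : ℝ) + σ i * Hn) / hw₂ i with hgdef
  have hg0 : ∀ i, 0 ≤ g i := fun i => by
    show 0 ≤ ((Rg i : ℝ) + σ i * Hn) / hw₂ i
    exact div_nonneg (add_nonneg (Nat.cast_nonneg _)
      (mul_nonneg (by linarith only [hσ1R i]) (Nat.cast_nonneg _))) (Nat.cast_nonneg _)
  -- the distinguished factor: Maier's deficit row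
  have hg₀ : g i₀ ≤ (1 - η₂ / 16) / Real.log X := by
    have hA4' : 20 * ((c₀ : ℝ) * Real.log X ^ lam) * Real.log X ≤ η₂ * h₂ :=
      calc 20 * ((c₀ : ℝ) * Real.log X ^ lam) * Real.log X
          = 20 * c₀ * (Real.log X ^ lam * Real.log X) := by ring
        _ ≤ 20 * c₀ * (Real.log N + Real.log 3) ^ (lam + 1) := hpoly
        _ ≤ η₂ * ((Real.log N - (Real.log (4 * c₀) + Real.log 3)) ^ A - 1) := q6
        _ ≤ η₂ * (Real.log N' ^ A - 1) :=
            mul_le_mul_of_nonneg_left (by linarith only [hbaseA']) hη₂0.le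
        _ ≤ η₂ * h₂ := mul_le_mul_of_nonneg_left hh₂ge hη₂0.le
    have key := deficit_endgame (c₀ := (c₀ : ℝ)) (H := Real.log X ^ lam) (Hd := 1) (HdP := 1)
      (R := (Rg i₀ : ℝ)) (cnt := ((Rg i₀ : ℝ) + c₀ * Real.log X ^ lam) / h₂) hη₂0 hη₂1 hh₂pos
      zero_le_one (by linarith only [hη₂0]) hlog3.le (by linarith only [hR1, q1]) hR4 (Nat.cast_nonneg _)
      (by rw [hRg₀]; exact hR₂)
      (q5.trans (mul_le_mul_of_nonneg_left (by linarith only [hR1]) hη₂0.le)) (by positivity) hA4'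
      (by rw [one_mul, mul_div_cancel₀ _ hh₂pos.ne'])
    rw [hgdef]
    simp only [hhw₂i₀, ← hc₀def]
    rw [one_div, ← div_eq_mul_inv] at key
    refine le_trans ?_ key
    rw [div_le_div_iff_of_pos_right hh₂pos]
    have : (c₀ : ℝ) * Hn ≤ c₀ * Real.log X ^ lam := mul_le_mul_of_nonneg_left hHnle hc0R.le
    linarith only [this]
  -- the other factors: long windows
  have hg : ∀ i, i ≠ i₀ → g i ≤ (1 + εm) / Real.log X := by
    intro i hi
    have hmv := hmv₂R i hi
    have hσq : (q₂ : ℝ) ≤ σ i * q₂ := le_mul_of_one_le_left hq₂pos.le (hσ1R i)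
    have hθ := hPNT i q₂ hq₂lowR hq₂upR (mv₂ i) hmv
    rw [abs_le] at hθ
    have hlo := card_mul_log_le_theta_window (mv₂ i) hL
    rw [hgdef]
    simp only [hhw₂i i hi]
    refine long_factor_upper (Llow := Real.log ((mv₂ i : ℝ) + 1))
      (θd := Chebyshev.theta ((mv₂ i + hL : ℕ) : ℝ) - Chebyshev.theta (mv₂ i : ℝ)) (E := εθ * N)
      hℓpos hhLpos hεm0.le ?_ (by linarith only [hθ.2]) ?_ (Nat.cast_nonneg _)
      (hEθ.trans (mul_le_mul_of_nonneg_right (by linarith only [hεminm]) hhLpos.le)) ?_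
    · rw [hmv, sub_add_cancel]
      exact Real.log_le_log hX0R (hXq₂.trans hσq)
    · simpa [hRgdef, hhw₂i i hi] using hlo
    · calc (σ i : ℝ) * Hn * Real.log X ≤ σS * Real.log X ^ lam * Real.log X :=
            mul_le_mul_of_nonneg_right (mul_le_mul (hσSR i) hHnle (Nat.cast_nonneg _)
              (by linarith only [hσS1R])) hℓpos.le
        _ ≤ εmin / 4 * hL := hshift
        _ ≤ εm / 4 * hL := mul_le_mul_of_nonneg_right (by linarith only [hεminm]) hhLpos.le
  -- the corner
  set z₂ : Fin d → ℤ := fun j => b₂ j + ∑ l, (k' l : ℤ) * v l j with hz₂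
  have hk'le : ∀ l, k' l < hw₂ l := fun l => mem_range.1 (Fintype.mem_piFinset.1 hk' l)
  have hh₁0 : (0 : ℤ) ≤ h₁ := by positivity
  have hz₂X : ∀ j, Xz ≤ z₂ j ∧ z₂ j ≤ 2 * Xz := by
    intro j
    have hB : ∀ l, |cf₂ l| + (k' l : ℤ) ≤ c₀ + h₂ + hL := fun l => by
      have e1 := hcf₂abs l
      have e2 : ((k' l : ℕ) : ℤ) ≤ h₂ + hL := by exact_mod_cast (hk'le l).le.trans (hhw₂le l)
      linarith only [e1, e2]
    have hab := abs_corner_sub_le' v q₂ cf₂ k' (by positivity) hB j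
    rw [← hVtdef] at hab
    have hE₂ : (c₀ + h₂ + hL) * Vt ≤ E := by
      rw [hEdef]; exact mul_le_mul_of_nonneg_right (by linarith only [hh₁0]) hVt0
    have hab' := abs_le.1 (hab.trans hE₂)
    have hzj : z₂ j = (q₂ + ∑ l, cf₂ l * v l j) + ∑ l, (k' l : ℤ) * v l j := by rw [hz₂]
    constructor
    · rw [hXzdef, hzj]; linarith only [hab'.1, min_le_right q₁ q₂]
    · rw [hzj]; linarith only [hab'.2, ho2]
  have hz₂0 : ∀ j, 0 ≤ z₂ j := fun j => ho6.trans (hz₂X j).1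
  have hcorn₂ : ∀ j, X ≤ (z₂ j).toNat ∧ (z₂ j).toNat ≤ 2 * X := fun j =>
    ⟨(Int.le_toNat (hz₂0 j)).2 (by rw [hXXz]; exact (hz₂X j).1),
      Int.toNat_le.2 (by push_cast; rw [hXXz]; exact (hz₂X j).2)⟩
  -- the lattice count `(⌊H⌋ + 1)^d ≤ (1 + η₂/200) H^d`
  have hHdP : ((Hn : ℝ) + 1) ^ d ≤ (1 + η₂ / 200) * (Real.log X ^ lam) ^ d := by
    have h1 : (Hn : ℝ) + 1 ≤ (1 + 1 / Real.log X ^ lam) * Real.log X ^ lam := by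
      rw [add_mul, one_mul, one_div, inv_mul_cancel₀ hHpos.ne']
      linarith only [hHnle]
    have hb : 0 < Real.log N - Real.log (4 * c₀) := by linarith only [q1, hlog3]
    have h2' : 1 / Real.log X ^ lam ≤ 1 / (Real.log N - Real.log (4 * c₀)) ^ lam :=
      one_div_le_one_div_of_le (Real.rpow_pos_of_pos hb lam)
        (Real.rpow_le_rpow hb.le hR1 hlam0.le)
    have h2 : (1 + 1 / Real.log X ^ lam) ^ d ≤
        (1 + 1 / (Real.log N - Real.log (4 * c₀)) ^ lam) ^ d :=
      pow_le_pow_left₀ (by positivity) (by linarith only [h2']) d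
    calc ((Hn : ℝ) + 1) ^ d ≤ ((1 + 1 / Real.log X ^ lam) * Real.log X ^ lam) ^ d :=
          pow_le_pow_left₀ (by positivity) h1 d
      _ = (1 + 1 / Real.log X ^ lam) ^ d * (Real.log X ^ lam) ^ d := mul_pow _ _ _
      _ ≤ (1 + η₂ / 200) * (Real.log X ^ lam) ^ d :=
          mul_le_mul_of_nonneg_right (h2.trans q7) (by positivity)
  have hdeficit : ∃ x : Fin d → ℕ, (∀ j, X ≤ x j ∧ x j ≤ 2 * X) ∧
      (primePatternCount Ψ x (Real.log X ^ lam) : ℝ) ≤ (1 - η₂ / 25) * smallScaleMainTerm Ψ lam X := by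
    refine ⟨fun j => (z₂ j).toNat, hcorn₂, ?_⟩
    rw [Frame.primePatternCount_eq_card Ψ hz₂0 (Real.log X ^ lam), hMT X]
    refine frame_deficit_final i₀ hη₂0 hη₂1 hℓpos (by positivity) hHdP hεm0.le hεmt hg0 hg₀ hg ?_
    -- the walk bound, cast to `ℝ`
    have hmain' : #K₂ * #{u ∈ U | ∀ i, ((Ψ i).eval (z₂ + fun j => (u j : ℤ))).toNat.Prime} ≤
        #U * ∏ i, (Rg i + (σ i).toNat * Hn) := by
      have := hmain₂
      simp only [hσi] at this
      exact this
    have h2 := (Nat.cast_le (α := ℝ)).2 hmain'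
    rw [Nat.cast_mul, Nat.cast_mul, Nat.cast_prod] at h2
    have h3 : ∏ i, (((Rg i + (σ i).toNat * Hn : ℕ)) : ℝ) = ∏ i, ((Rg i : ℝ) + σ i * Hn) :=
      prod_congr rfl fun i _ => by
        have : ((σ i).toNat : ℤ) = σ i := Int.toNat_of_nonneg (by linarith only [hσ1 i])
        push_cast; rw [← this]; norm_cast
    rw [h3, hUcard, hK₂card] at h2
    have hprodg : ∏ i, g i = (∏ i, ((Rg i : ℝ) + σ i * Hn)) / ∏ i, (hw₂ i : ℝ) := by
      rw [hgdef, ← prod_div_distrib]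
    have hWpos : (0 : ℝ) < ∏ i, (hw₂ i : ℝ) := prod_pos fun i _ => by exact_mod_cast hhw₂pos i
    rw [hprodg, mul_div_assoc', le_div_iff₀ hWpos]
    linarith only [h2]
  exact ⟨X, hX₀X, hsurplus, hdeficit⟩




/-- **Dual frames exist iff the system is onto.** For linear forms, `Ψ` admits a dual frame iff
`n ↦ (ψ₁(n), …, ψ_t(n))`, `ℤ^d → ℤ^t`, is surjective (a frame maps `∑_l y_l v_l ↦ y`;
conversely preimages of the standard basis vectors form a frame); elementary linear algebra
(such systems have complexity `0` in the sense of Green–Tao 2010, Def. 1.5). [folklore] -/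
theorem exists_isDualFrame_iff (Ψ : Fin t → AffLinForm d) (h0 : ∀ i, (Ψ i).const = 0) :
    (∃ v, IsDualFrame Ψ v) ↔ Function.Surjective fun (n : Fin d → ℤ) (i : Fin t) => (Ψ i).eval n := by
  constructor
  · rintro ⟨v, hv⟩ y
    refine ⟨fun j => ∑ l, y l * v l j, funext fun i => ?_⟩
    show (Ψ i).eval (fun j => ∑ l, y l * v l j) = y i
    rw [eval_sum_mul _ (h0 i), sum_eq_single i (fun l _ hl => by rw [hv i l, if_neg (Ne.symm hl), mul_zero])
      (fun h => absurd (mem_univ i) h), hv i i, if_pos rfl, mul_one]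
  · intro hs
    choose w hw using fun l : Fin t => hs (Pi.single l 1)
    refine ⟨w, fun i l => ?_⟩
    have := congrFun (hw l) i
    simp only at this
    rw [this, Pi.single_apply]

/-- A Bézout vector of a single form is a dual frame: the case `t = 1` of the frame theorem is
the primitive case of `SmallScalePatternsProofs.lean`. [folklore] -/
theorem isDualFrame_fin_one (Ψ : Fin 1 → AffLinForm d) {w : Fin d → ℤ} (hw : (Ψ 0).eval w = 1) :
    IsDualFrame Ψ (fun _ => w) := by
  intro i l
  fin_cases i; fin_cases l
  simpa using hw

end Frame

/-! ## The theorems -/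

/-- **Pandey–Woo, Theorem 5, for systems with a dual frame — PROVED.** For all `d, t ≥ 1`, every
in-scope system `Ψ = (ψ₁, …, ψ_t)` of linear forms on `ℤ^d` (finite complexity, non-negative
coefficients, no zero form) that admits a dual frame `v₁, …, v_t ∈ ℤ^d` (`ψᵢ(v_l) = δ_{il}`;
equivalently `Ψ : ℤ^d → ℤ^t` is onto), and every `λ > 1`, there are `δ⁺, δ⁻ > 0` such that for
arbitrarily large `X`, with `H = (log X)^λ`, some box `∏ⱼ [xⱼ, xⱼ + H]` with corner in `[X, 2X]^d`
contains at least `(1 + δ⁺) H^d (log X)^{-t} ∏_p β_p` points `n` with `ψ₁(n), …, ψ_t(n)` all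
prime, and another at most `(1 − δ⁻) H^d (log X)^{-t} ∏_p β_p` of them: the conclusion of
`SmallScalePatternIrregularity` for these systems (all of complexity `0`; here `∏_p β_p = 1`).
[cite: PandeyWoo2024, Theorem 5 and §2.4] [cite: Maier1985, Theorem] -/
theorem smallScalePatternIrregularity_of_frame (_hd : 1 ≤ d) (ht : 1 ≤ t)
    (Ψ : Fin t → AffLinForm d) (hΨ : InScope Ψ) {v : Fin t → Fin d → ℤ} (hv : Frame.IsDualFrame Ψ v)
    {lam : ℝ} (hlam : 1 < lam) :
    ∃ δp δm : ℝ, 0 < δp ∧ 0 < δm ∧ ∀ X₀ : ℕ, ∃ X : ℕ, X₀ ≤ X ∧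
      (∃ x : Fin d → ℕ, (∀ j, X ≤ x j ∧ x j ≤ 2 * X) ∧
        (1 + δp) * smallScaleMainTerm Ψ lam X ≤ primePatternCount Ψ x ((Real.log X) ^ lam)) ∧
      (∃ x : Fin d → ℕ, (∀ j, X ≤ x j ∧ x j ≤ 2 * X) ∧
        (primePatternCount Ψ x ((Real.log X) ^ lam) : ℝ) ≤ (1 - δm) * smallScaleMainTerm Ψ lam X) := by
  obtain ⟨-, hconst, hcoef, hnz⟩ := hΨ
  exact Frame.irregularity Ψ hconst hcoef hnz hv ⟨0, ht⟩ hlam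

/-- **Pandey–Woo, Theorem 5, for onto systems — PROVED** (the same statement with the
hypothesis in its invariant form): every in-scope system `Ψ` for which
`n ↦ (ψ₁(n), …, ψ_t(n))`, `ℤ^d → ℤ^t`, is surjective satisfies the conclusion of
`SmallScalePatternIrregularity`. [cite: PandeyWoo2024, Theorem 5 and §2.4] [cite: Maier1985, Theorem] -/
theorem smallScalePatternIrregularity_of_surjective (hd : 1 ≤ d) (ht : 1 ≤ t)
    (Ψ : Fin t → AffLinForm d) (hΨ : InScope Ψ)
    (hs : Function.Surjective fun (n : Fin d → ℤ) (i : Fin t) => (Ψ i).eval n)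
    {lam : ℝ} (hlam : 1 < lam) :
    ∃ δp δm : ℝ, 0 < δp ∧ 0 < δm ∧ ∀ X₀ : ℕ, ∃ X : ℕ, X₀ ≤ X ∧
      (∃ x : Fin d → ℕ, (∀ j, X ≤ x j ∧ x j ≤ 2 * X) ∧
        (1 + δp) * smallScaleMainTerm Ψ lam X ≤ primePatternCount Ψ x ((Real.log X) ^ lam)) ∧
      (∃ x : Fin d → ℕ, (∀ j, X ≤ x j ∧ x j ≤ 2 * X) ∧
        (primePatternCount Ψ x ((Real.log X) ^ lam) : ℝ) ≤ (1 - δm) * smallScaleMainTerm Ψ lam X) := by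
  obtain ⟨v, hv⟩ := (Frame.exists_isDualFrame_iff Ψ hΨ.2.1).2 hs
  exact smallScalePatternIrregularity_of_frame hd ht Ψ hΨ hv hlam

/-- **Theorem 5 (systems with a dual frame) refutes Cramér-type small-scale uniformity —
PROVED**: for every in-scope system with a dual frame and every `λ > 1`,
`SmallScaleUniformity Ψ λ` fails. [cite: PandeyWoo2024, Theorem 5 and §1 (p. 3)] -/
theorem not_smallScaleUniformity_of_frame (hd : 1 ≤ d) (ht : 1 ≤ t) {Ψ : Fin t → AffLinForm d}
    (hΨ : InScope Ψ) {v : Fin t → Fin d → ℤ} (hv : Frame.IsDualFrame Ψ v) {lam : ℝ}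
    (hlam : 1 < lam) : ¬ SmallScaleUniformity Ψ lam := by
  intro hU
  obtain ⟨δp, δm, hδp, -, hX⟩ := smallScalePatternIrregularity_of_frame hd ht Ψ hΨ hv hlam
  obtain ⟨X₀, hX₀⟩ := hU (δp / 2) (half_pos hδp)
  obtain ⟨X, hXge, ⟨x, hx, hcount⟩, -⟩ := hX (max X₀ 2)
  have hXX₀ : X₀ ≤ X := le_trans (le_max_left _ _) hXge
  have hX2 : 2 ≤ X := le_trans (le_max_right _ _) hXge
  have hS : 0 < singularProduct Ψ := by
    rw [Frame.singularProduct_eq_one_of_frame Ψ hΨ.2.1 hv]; exact one_pos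
  have hM := smallScaleMainTerm_pos (lam := lam) hS hX2
  have hup := hX₀ X hXX₀ x hx
  rw [abs_le] at hup
  nlinarith [hup.2]

/-! ## An in-scope example with two forms: `apSystem 2 = (x, x + y)` -/

/-- The dual frame of `apSystem 2 = (x, x + y)`: `v₀ = (1, −1)`, `v₁ = (0, 1)` (`x(v₀) = 1`,
`(x+y)(v₀) = 0`, `x(v₁) = 0`, `(x+y)(v₁) = 1`). [folklore] -/
def pairFrame : Fin 2 → Fin 2 → ℤ := ![![1, -1], ![0, 1]]

/-- `pairFrame` is a dual frame for `apSystem 2 = (x, x + y)`. [folklore] -/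
theorem apSystem_two_isDualFrame : Frame.IsDualFrame (apSystem 2) pairFrame := by
  intro i l
  fin_cases i <;> fin_cases l <;> simp [apSystem, pairFrame, AffLinForm.eval, Fin.sum_univ_two]

/-- **Small-scale irregularity of the prime pairs `(x, x + y)` — PROVED**: the conclusion of
`SmallScalePatternIrregularity` for `apSystem 2`, an instance with two coupled forms
(scope: `APSystem.inScope 2`). [cite: PandeyWoo2024, Theorem 5] -/
theorem smallScalePatternIrregularity_apSystem_two {lam : ℝ} (hlam : 1 < lam) :
    ∃ δp δm : ℝ, 0 < δp ∧ 0 < δm ∧ ∀ X₀ : ℕ, ∃ X : ℕ, X₀ ≤ X ∧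
      (∃ x : Fin 2 → ℕ, (∀ j, X ≤ x j ∧ x j ≤ 2 * X) ∧
        (1 + δp) * smallScaleMainTerm (apSystem 2) lam X ≤
          primePatternCount (apSystem 2) x ((Real.log X) ^ lam)) ∧
      (∃ x : Fin 2 → ℕ, (∀ j, X ≤ x j ∧ x j ≤ 2 * X) ∧
        (primePatternCount (apSystem 2) x ((Real.log X) ^ lam) : ℝ) ≤
          (1 - δm) * smallScaleMainTerm (apSystem 2) lam X) :=
  smallScalePatternIrregularity_of_frame (by norm_num) (by norm_num) (apSystem 2) (APSystem.inScope 2)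
    apSystem_two_isDualFrame hlam

/-- Hence Cramér-type small-scale uniformity fails for the prime pairs `(x, x + y)` at every
`λ > 1` — unconditionally (compare the conditional
`SmallScalePatternIrregularity.not_smallScaleUniformity_apSystem` of `SmallScalePatternsAP.lean`).
[cite: PandeyWoo2024, Theorem 5 and §1 (p. 3)] -/
theorem not_smallScaleUniformity_apSystem_two {lam : ℝ} (hlam : 1 < lam) :
    ¬ SmallScaleUniformity (apSystem 2) lam :=
  not_smallScaleUniformity_of_frame (by norm_num) (by norm_num) (APSystem.inScope 2)
    apSystem_two_isDualFrame hlam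

end Literature.Barriers.Parity
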